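import Summits.Ventures.HSemireg.WedgeHankelRecurrenceSum
import Summits.Ventures.HSemireg.WedgeHankelRecurrenceAffinePolar

/-!
# Venture HSemireg — SUMS WITH A NODE AT INFINITY: **if `q` has middle rank `r` with monic minimal recurrence `m` of degree `r − e` (a polar part of order `e` at `∞`) and `q′` has middle
# rank `r′` with minimal recurrence `m′` of FULL degree `r′`, and `m`, `m′` are coprime, then `R(q + q′) = r + r′` and the minimal recurrence of `q + q′` is `m · m′`** (`2(r + r′) ≤ N + 1`) —
# N31's additivity extended to ONE summand with a node at infinity (with two, `δ_N + δ_N` shows it fails): disjoint supports on `P¹` add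

HONEST FRAMING. Part of the Lean index of the computation cell `pub-hsemireg` (seat p10 gen 27, Sunday typer «UNIFORM-IN-n»).
LINEAR ALGEBRA OF HANKEL (catalecticant) MATRICES and of polynomials over a field ONLY: no variety, no cohomology theory, no sheaf, no Ext group and no semiregularity map is constructed
here; nothing here says that HC / HC_CM / HC_AV holds; no Literature fact is declared or used.  Custodian versions as in `WedgeHankelSiegelIdeal` (1/3); the dictionary (supports on `P¹`:
`{m = 0} ⊔ e·∞` and `{m′ = 0}`, disjoint iff `IsCoprime m m′` and `m′` has no degree drop) is QUOTED, never asserted.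

WHAT IS KEYED.  N31 (`WedgeHankelRecurrenceSum`, № 260): `rank_hankel1_half_add_eq_of_isCoprime`, `recSpace_add_self_eq_span_mul_of_isCoprime` (coprime FULL-degree minimal recurrences);
N34 (`WedgeHankelRecurrenceAffinePolar`, claim #4 v2): `exists_dualSeq_eq_below_of_mem_recSpace`, `rank_hankel1_half_affine`, `tail_apply_ne_zero`, `rank_hankel1_half_congr`; N33 (№ 264):
`rank_hankel1_half_add_tail`, `recSpace_add_tail_self_eq_span`; N32 (№ 263): `dualSeq`, `mem_recSpace_dualSeq`; N18 (№ 173): `mul_mem_recSpace_add_seq`; N23 (№ 176) `recSpace_congr`.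
THIS FILE (namespace `Summit.Ventures.HSemireg.Wedge.HankelOuter` continued; CHAINED on N31 + N34; 0 definitions):
* §522 for `R(q) = r`, `m ∈ Rec_r(q)` monic with `deg m + e = r`; `R(q′) = r′`, `0 ≠ m′ ∈ Rec_{r′}(q′)`, `deg m′ = r′`; `IsCoprime m m′`; `2(r + r′) ≤ N + 1`:
  **`rank_hankel1_half_add_eq_of_isCoprime_polar`** (`R(q + q′) = r + r′`), **`recSpace_add_self_eq_span_mul_of_isCoprime_polar`** (`Rec_{r+r′}(q + q′) = K · (m · m′)`: the minimal recurrence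
  of the sum is the product, of degree `r + r′ − e` — the sum inherits `q`'s node at infinity with its order), `natDegree_mul_add_eq` (bookkeeping: `deg(m m′) + e = r + r′`).
READING: N31 excluded degree drops; N33/N34 explained them as polar parts at `∞`; this file puts the two together — the affine part of `q` and `q′` add by N31, and `q`'s polar part rides
on top by N33.  Symmetric in the obvious way; with polar parts on BOTH sides the supports meet at `∞` and additivity fails (`δ_N + δ_N`: `R = 1 ≠ 2`).  Nothing Ext-side.  New names only.
-/

open Module Polynomial
open scoped Matrix Polynomial

namespace Summit.Ventures.HSemireg.Wedge.HankelOuter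

open Summit.Ventures.HSemireg.Wedge Summit.Ventures.HSemireg.Wedge.Hankel

variable (K : Type*) [Field K] {N : ℕ}

/-! ## §522. One summand with a node at infinity: the affine parts add (N31), the polar part rides on top (N33) -/

section SumPolar

variable {r r' e : ℕ} {q q' : ℕ → K} {m m' : K[X]}
  (hq : (hankel1 K N (N / 2) q).rank = r) (hm : m ∈ recSpace K N q r) (hmo : m.Monic) (hde : m.natDegree + e = r)
  (hq' : (hankel1 K N (N / 2) q').rank = r') (hm' : m' ∈ recSpace K N q' r') (hm'0 : m' ≠ 0) (hm'r : m'.natDegree = r') (hcop : IsCoprime m m')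
  (h2 : r + r' + (r + r') ≤ N + 1)
include hq hm hmo hde hq' hm' hm'0 hm'r hcop h2

/-- **ADDITIVITY WITH ONE NODE AT INFINITY: `R(q + q′) = R(q) + R(q′)`** for coprime minimal recurrences, `m′` of full degree, `m` monic of degree `r − e` (any `e`), `2(r + r′) ≤ N + 1`.
Proof: `q = u + τ` with `u = dualSeq m a` of middle rank `r − e` (N34) and `τ` a polar part of exact order `e`; `R(u + q′) = (r − e) + r′` with minimal recurrence `m m′` of full degree (N31);
then the tail adds `e` (N33). -/
theorem rank_hankel1_half_add_eq_of_isCoprime_polar : (hankel1 K N (N / 2) (q + q')).rank = r + r' := by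
  have heN : e ≤ N := by omega
  obtain ⟨a, -, haff⟩ := exists_dualSeq_eq_below_of_mem_recSpace K hmo heN (q := q) (by rw [hde]; exact hm)
  set u := dualSeq K m a with hu_def
  have hmu : m ∈ recSpace K N u m.natDegree := mem_recSpace_dualSeq K hmo a
  have hu : (hankel1 K N (N / 2) u).rank = m.natDegree := rank_hankel1_half_affine K hq hde haff hmu hmo.ne_zero (by omega)
  -- the affine parts add (N31)
  have hv : (hankel1 K N (N / 2) (u + q')).rank = m.natDegree + r' :=
    rank_hankel1_half_add_eq_of_isCoprime K hu hq' hmu hm' hmo.ne_zero hm'0 rfl hm'r hcop (by omega)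
  have hmm' : m * m' ∈ recSpace K N (u + q') (m.natDegree + r') := mul_mem_recSpace_add_seq K hmu hm'
  have hqsum : q + q' = (u + q') + (q - u) := by funext j; simp only [Pi.add_apply, Pi.sub_apply]; ring
  rcases Nat.eq_zero_or_pos e with he0 | he
  · -- no polar part: `q = u` on `[0, N]`
    subst he0
    have hagree : ∀ j ≤ N, (q + q') j = (u + q') j := fun j hj => by rw [Pi.add_apply, Pi.add_apply, haff j (by omega)]
    rw [rank_hankel1_half_congr K hagree, hv, ← hde, add_zero]
  · -- a polar part of exact order `e` on top of the affine sum
    have hτ : ∀ j, j + e ≤ N → (q - u) j = 0 := fun j hj => by rw [Pi.sub_apply, haff j hj, sub_self]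
    have hτe : (q - u) (N + 1 - e) ≠ 0 := tail_apply_ne_zero K hq hde haff hmu hmo.ne_zero he
    rw [hqsum, rank_hankel1_half_add_tail K hv hmm' (mul_ne_zero hmo.ne_zero hm'0) (by rw [Polynomial.natDegree_mul hmo.ne_zero hm'0, hm'r]) hτ hτe he (by omega)]
    omega

/-- **… with minimal recurrence the product: `Rec_{r+r′}(q + q′) = K · (m · m′)`** (of degree `r + r′ − e`: the sum keeps `q`'s node at infinity with its order `e`). -/
theorem recSpace_add_self_eq_span_mul_of_isCoprime_polar : recSpace K N (q + q') (r + r') = K ∙ (m * m') := by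
  have heN : e ≤ N := by omega
  obtain ⟨a, -, haff⟩ := exists_dualSeq_eq_below_of_mem_recSpace K hmo heN (q := q) (by rw [hde]; exact hm)
  set u := dualSeq K m a with hu_def
  have hmu : m ∈ recSpace K N u m.natDegree := mem_recSpace_dualSeq K hmo a
  have hu : (hankel1 K N (N / 2) u).rank = m.natDegree := rank_hankel1_half_affine K hq hde haff hmu hmo.ne_zero (by omega)
  have hv : (hankel1 K N (N / 2) (u + q')).rank = m.natDegree + r' :=
    rank_hankel1_half_add_eq_of_isCoprime K hu hq' hmu hm' hmo.ne_zero hm'0 rfl hm'r hcop (by omega)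
  have hmm' : m * m' ∈ recSpace K N (u + q') (m.natDegree + r') := mul_mem_recSpace_add_seq K hmu hm'
  have hqsum : q + q' = (u + q') + (q - u) := by funext j; simp only [Pi.add_apply, Pi.sub_apply]; ring
  rcases Nat.eq_zero_or_pos e with he0 | he
  · subst he0
    have hagree : ∀ j ≤ N, (q + q') j = (u + q') j := fun j hj => by rw [Pi.add_apply, Pi.add_apply, haff j (by omega)]
    rw [recSpace_congr K hagree, show r + r' = m.natDegree + r' by omega]
    exact recSpace_add_self_eq_span_mul_of_isCoprime K hu hq' hmu hm' hmo.ne_zero hm'0 rfl hm'r hcop (by omega)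
  · have hτ : ∀ j, j + e ≤ N → (q - u) j = 0 := fun j hj => by rw [Pi.sub_apply, haff j hj, sub_self]
    have hτe : (q - u) (N + 1 - e) ≠ 0 := tail_apply_ne_zero K hq hde haff hmu hmo.ne_zero he
    rw [hqsum, show r + r' = m.natDegree + r' + e by omega]
    exact recSpace_add_tail_self_eq_span K hv hmm' (mul_ne_zero hmo.ne_zero hm'0) (by rw [Polynomial.natDegree_mul hmo.ne_zero hm'0, hm'r]) hτ hτe he (by omega)

omit hq hm hq' hm' hcop h2 in
/-- bookkeeping: `deg(m · m′) + e = r + r′` — the product drops below its window `r + r′` by exactly `q`'s order at infinity. -/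
theorem natDegree_mul_add_eq : (m * m').natDegree + e = r + r' := by
  rw [Polynomial.natDegree_mul hmo.ne_zero hm'0, hm'r]; omega

end SumPolar

end Summit.Ventures.HSemireg.Wedge.HankelOuter
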